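import Mathlib
import Summits.NavierStokesRegularity.NavierStokesRegularity.Theorems.TaoLadderRungTwoBreakBlowupRigidityOneOneHopAbsorbing
import HarnessLib

/-!
# FINITE-DEPTH TABLES: if the modes reachable from the datum die out after `K` hops, the one-shell datum generates a
  GLOBAL EXACT `(K+1)`-shell lattice flow, so there is no Theorem-4.2-level blow-up at ANY scale ratio — the general
  form of the void / frozen / one-hop corners of K2(1) `TaoLadderRungTwoBreak.BlowupRigidityOne`
  (stmt-NavierStokesRegularity-20206; `--supports`)

MODEL lattice ODEs only (Tao 2016 §4 (4.1)–(4.3), Lemma 4.1 (4.5)–(4.8), (4.12), Thm. 4.2 statement shape; §5 p. 25);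
nothing here is a statement about the Navier–Stokes equations; NO item is closed.  DEF-FREE; ROUTE-INDEPENDENT.

THE CLASS.  A SUPPORT CHAIN of depth `K` for the table `α` is a sequence of mode sets `D 0, D 1, …` (`D : ℕ → Finset`)
with `D (K+1) = ∅` and, for every level `n`,
  (O)  `α_{jk i,(0,0,1)} = 0` for `j, k ∈ D n`, `i ∉ D (n+1)`        — the outflow of a `D n`-state lands in `D (n+1)`;
  (A)  `α_{jk i,(0,0,0)} = 0` for `j, k ∈ D n`, `i ∉ D n`            — the rotor keeps `V_{D n}` invariant;
  (B)  `α_{jk i,(1,0,0)} = 0` and `α_{kj i,(0,1,0)} = 0` for `j ∈ D (n+1)`, `k ∈ D n`, `i ∉ D n`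
                                                                     — the back-reaction of a `D(n+1)`-state on a
                                                                       `D n`-state stays in `V_{D n}`.
Then from every datum supported in `D 0` the exact lattice lives on shells `0 … K` with shell `n` supported in `D n`
for ever: energy climbs at most `K` shells and the top shell never emits ((O) at level `K`).  Depth `0` with
`D 0 = {b}` is the frozen one-mode state of a square-free table (`…SquareFreeOneMode`); `D 0 = univ, D 1 = ∅` is the
outflow-free corner (`…VoidTables`); `D 0 = univ, D 1 = D, D 2 = ∅` is the one-hop corner with an absorbing dead
set (`…OneHopAbsorbing`; there (B) is automatic since `D 2 = ∅` and `D 0 = univ`).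

* `sum_inner_truncatedField_eq_zero` — the TRUNCATED-LATTICE ENERGY IDENTITY: for any cancelling table, any gains
  `Λ n` and any shell vectors `v 0, …, v K` (`v (K+1) = 0`),
  `Σ_{s ≤ K} ⟪v s, Λ s Q(v s) + Λ s B(v (s+1), v s) + Λ (s−1) A(v (s−1))⟫ = 0` (telescoping of the type-split
  cancellation `⟪y, A x⟫ + ⟪x, B(y,x)⟫ = 0`, `table_sTable`);
* `exists_regularExactFlow_of_supportChain`, `not_noGlobalCascade_of_supportChain` — a cancelling table with a
  support chain of depth `K` carries, from every datum supported in `D 0` and for every horizon, an EXACT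
  (4.5)-regular lattice flow (the global trajectory of the projected truncated field on `ℝ^{(K+1) m}`, energy-neutral
  by the identity above, via `exists_solution_of_sum_mul_eq_zero`); hence on `E₂(R)` no robust blow-up from such
  data, every `ε₀ > 0`;
* `not_noGlobalCascade_of_supportChain_univ` — with `D 0 = univ`: no robust blow-up from ANY one-shell datum.

HONEST LABEL: calibration of one aside leaf on an explicit sub-class (the `K`-hop generalisation announced as (RP) in
this hand's census); no stub, crux, rung or summit is proved; rung 0.
-/

noncomputable section

-- the summit and its single sub-problem share the name (CONVENTIONS §1)
set_option linter.dupNamespace false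

open Set Filter Topology MeasureTheory
open scoped RealInnerProductSpace

namespace Summit.NavierStokesRegularity.NavierStokesRegularity.Theorems

namespace BlowupRigidityOne

open Literature.Analysis.FluidPDE Literature.Analysis.FluidPDE.TaoCascade
  Literature.Analysis.FluidPDE.Tao2016AveragedNS

variable {m : ℕ} {R ε₀ : ℝ} {α : Fin m → Fin m → Fin m → ℤ × ℤ × ℤ → ℝ}

/-! ## The truncated-lattice energy identity -/

/-- **Energy identity of a truncated lattice.**  For a cancelling table, any gains `Λ : ℕ → ℝ` and any shell vectors
`v : ℕ → ℝ^m` with `v (K+1) = 0`: `Σ_{s=0}^{K} ⟪v s, Λ s Q(v s) + Λ s B(v (s+1), v s) + [s ≥ 1] Λ (s−1) A(v (s−1))⟫ = 0`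
— intra-shell neutrality kills the rotor, and the flux `Λ r ⟪v (r+1), A(v r)⟫` received by shell `r+1` cancels the
back-reaction work `Λ r ⟪v r, B(v (r+1), v r)⟫` on shell `r` (`table_sTable`), telescoping in `r`.
[cite: Tao2016AveragedNS, §4 (4.3), Lemma 4.1 (4.8)–(4.9); §5 (g-cancel)] -/
theorem sum_inner_truncatedField_eq_zero (hc : IsCancellingCoeff α) (K : ℕ) (Λ : ℕ → ℝ) (v : ℕ → Em m)
    (hvK : v (K + 1) = 0) :
    ∑ s : Fin (K + 1),
      ⟪v s, Λ s • tableQ α (v s) + Λ s • tableB α (v (s + 1)) (v s)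
        + (if (s : ℕ) = 0 then (0 : Em m) else Λ (s - 1) • tableA α (v (s - 1)))⟫ = 0 := by
  have hST := table_sTable α hc
  have hterm : ∀ s : Fin (K + 1),
      ⟪v s, Λ s • tableQ α (v s) + Λ s • tableB α (v (s + 1)) (v s)
        + (if (s : ℕ) = 0 then (0 : Em m) else Λ (s - 1) • tableA α (v (s - 1)))⟫
      = Λ s * ⟪v s, tableB α (v (s + 1)) (v s)⟫
        + (if (s : ℕ) = 0 then 0 else Λ (s - 1) * ⟪v s, tableA α (v (s - 1))⟫) := by
    intro s
    rw [inner_add_right, inner_add_right, inner_smul_right, inner_smul_right, hST.intra, mul_zero, zero_add]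
    split_ifs <;> simp [inner_smul_right]
  rw [Finset.sum_congr rfl fun s _ => hterm s, Finset.sum_add_distrib]
  rw [Fin.sum_univ_castSucc, Fin.sum_univ_succ]
  simp only [Fin.val_castSucc, Fin.val_last, Fin.val_zero, if_true, Fin.val_succ, Nat.succ_ne_zero, if_false,
    Nat.add_sub_cancel, zero_add]
  rw [hvK, (show tableB α (0 : Em m) (v K) = 0 by ext i; simp [tableB_apply, qform]), inner_zero_right, mul_zero,
    add_zero, ← Finset.sum_add_distrib]
  refine Finset.sum_eq_zero fun r _ => ?_
  have h := hST.cancel (v r) (v (r + 1))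
  calc Λ r * ⟪v r, tableB α (v (r + 1)) (v r)⟫ + Λ r * ⟪v (r + 1), tableA α (v r)⟫
      = Λ r * (⟪v (r + 1), tableA α (v r)⟫ + ⟪v r, tableB α (v (r + 1)) (v r)⟫) := by ring
    _ = 0 := by rw [h, mul_zero]

/-! ## Vanishing of the table maps off a support chain -/

/-- (O): the outflow of a `D`-supported state has no component off `D'`.
[cite: Tao2016AveragedNS, §4 (4.1), Lemma 4.1 (4.8); cell vocabulary (support chain (O))] -/
theorem tableA_apply_eq_zero_of_chain {D D' : Finset (Fin m)}
    (hO : ∀ j k i, j ∈ D → k ∈ D → i ∉ D' → α j k i ((0 : ℤ), (0 : ℤ), (1 : ℤ)) = 0)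
    {x : Em m} (hx : ∀ i, i ∉ D → x i = 0) {i : Fin m} (hi : i ∉ D') : tableA α x i = 0 := by
  simp only [tableA_apply, qform]
  refine Finset.sum_eq_zero fun j _ => Finset.sum_eq_zero fun k _ => ?_
  by_cases hj : j ∈ D
  · by_cases hk : k ∈ D
    · rw [hO j k i hj hk hi, zero_mul]
    · rw [hx k hk, mul_zero, mul_zero]
  · rw [hx j hj, zero_mul, mul_zero]

/-- (B): the back-reaction of a `D'`-supported state on a `D`-supported state has no component off `D`.
[cite: Tao2016AveragedNS, §4 (4.1), Lemma 4.1 (4.8); cell vocabulary (support chain (B))] -/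
theorem tableB_apply_eq_zero_of_chain {D D' : Finset (Fin m)}
    (hB : ∀ j k i, j ∈ D' → k ∈ D → i ∉ D →
      α j k i ((1 : ℤ), (0 : ℤ), (0 : ℤ)) = 0 ∧ α k j i ((0 : ℤ), (1 : ℤ), (0 : ℤ)) = 0)
    {y x : Em m} (hy : ∀ i, i ∉ D' → y i = 0) (hx : ∀ i, i ∉ D → x i = 0) {i : Fin m} (hi : i ∉ D) :
    tableB α y x i = 0 := by
  have h100 : ∑ j, ∑ k, α j k i ((1 : ℤ), (0 : ℤ), (0 : ℤ)) * (y j * x k) = 0 := by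
    refine Finset.sum_eq_zero fun j _ => Finset.sum_eq_zero fun k _ => ?_
    by_cases hj : j ∈ D'
    · by_cases hk : k ∈ D
      · rw [(hB j k i hj hk hi).1, zero_mul]
      · rw [hx k hk, mul_zero, mul_zero]
    · rw [hy j hj, zero_mul, mul_zero]
  have h010 : ∑ k, ∑ j, α k j i ((0 : ℤ), (1 : ℤ), (0 : ℤ)) * (x k * y j) = 0 := by
    refine Finset.sum_eq_zero fun k _ => Finset.sum_eq_zero fun j _ => ?_
    by_cases hj : j ∈ D'
    · by_cases hk : k ∈ D
      · rw [(hB j k i hj hk hi).2, zero_mul]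
      · rw [hx k hk, zero_mul, mul_zero]
    · rw [hy j hj, mul_zero, mul_zero]
  rw [tableB_apply]
  unfold qform
  rw [h100, h010, add_zero]


/-! ## The projected truncated flow of a support chain -/

/-- **A CANCELLING TABLE WITH A SUPPORT CHAIN OF DEPTH `K` FLOWS GLOBALLY AND EXACTLY.**  Let `α` be cancelling with a
support chain `D` of depth `K` ((O), (A), (B), `D (K+1) = ∅`).  For every `ε₀`, every horizon `T` and every one-shell
datum `X₀` supported in `D 0` there is an EXACT lattice flow on `[0,T]` (datum (4.7), the law (4.8)/(4.12) with no
defect as a one-sided derivative within `[0,T]`, the a priori weight (4.5)): the global trajectory of the projected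
truncated field on `ℝ^{(K+1)·m}` — shell `n ≤ K` projected onto `V_{D n}` and driven by `Λ_n Q + Λ_n B(·_{n+1}, ·) +
Λ_{n−1} A(·_{n−1})`, energy-neutral by `sum_inner_truncatedField_eq_zero` — put on shells `0 … K`, zero elsewhere;
(A), (B), (O) make the dark modes of every shell obey the law, (O) at level `K` freezes shell `K+1`.
[cite: Tao2016AveragedNS, §4 Lemma 4.1 (4.5), (4.7), (4.8), (4.12); §5 p. 25 (cancelling circuits are globally well posed)] -/
theorem exists_regularExactFlow_of_supportChain (hc : IsCancellingCoeff α) {K : ℕ} {D : ℕ → Finset (Fin m)}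
    (hDK : D (K + 1) = ∅)
    (hO : ∀ n j k i, j ∈ D n → k ∈ D n → i ∉ D (n + 1) → α j k i ((0 : ℤ), (0 : ℤ), (1 : ℤ)) = 0)
    (hA : ∀ n j k i, j ∈ D n → k ∈ D n → i ∉ D n → α j k i ((0 : ℤ), (0 : ℤ), (0 : ℤ)) = 0)
    (hB : ∀ n j k i, j ∈ D (n + 1) → k ∈ D n → i ∉ D n →
      α j k i ((1 : ℤ), (0 : ℤ), (0 : ℤ)) = 0 ∧ α k j i ((0 : ℤ), (1 : ℤ), (0 : ℤ)) = 0)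
    (ε₀ : ℝ) {X₀ : Fin m → ℝ} (hX₀ : ∀ i, i ∉ D 0 → X₀ i = 0) (T : ℝ) :
    ∃ X : Fin m → ℤ → ℝ → ℝ,
      (∀ i k, X i k 0 = if k = 0 then X₀ i else 0) ∧
      (∀ i k, ∀ t ∈ Icc 0 T, HasDerivWithinAt (X i k) (quadTerm ε₀ α X i k t) (Icc 0 T) t) ∧
      ∃ M : ℝ, ∀ t ∈ Icc 0 T, ∀ (i : Fin m) (k : ℤ),
        (1 + (1 + ε₀) ^ ((10 : ℝ) * k)) * |X i k t| ≤ M := by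
  classical
  -- gains, projected shell vectors, truncated field, projected field on coordinates
  set Λ : ℕ → ℝ := fun n => (1 + ε₀) ^ ((5 : ℝ) * (n : ℝ) / 2) with hΛ
  set v : (Fin (K + 1) × Fin m → ℝ) → ℕ → Em m := fun z n =>
    WithLp.toLp 2 fun i => if h : n < K + 1 then (if i ∈ D n then z (⟨n, h⟩, i) else 0) else 0 with hv
  have v_apply : ∀ z n i, v z n i = if h : n < K + 1 then (if i ∈ D n then z (⟨n, h⟩, i) else 0) else 0 :=
    fun z n i => by simp [hv]
  have v_supp : ∀ z n i, i ∉ D n → v z n i = 0 := fun z n i hi => by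
    rw [v_apply]; split_ifs <;> rfl
  have v_high : ∀ z n, K + 1 ≤ n → v z n = 0 := fun z n hn => by
    ext i; rw [v_apply, dif_neg (by omega)]; rfl
  have v_mem : ∀ z (s : Fin (K + 1)) i, i ∈ D s → v z s i = z (s, i) := fun z s i hi => by
    rw [v_apply, dif_pos s.2, if_pos hi]
  set F : (Fin (K + 1) × Fin m → ℝ) → ℕ → Em m := fun z n =>
    Λ n • tableQ α (v z n) + Λ n • tableB α (v z (n + 1)) (v z n)
      + (if n = 0 then (0 : Em m) else Λ (n - 1) • tableA α (v z (n - 1))) with hF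
  have F_apply : ∀ z n i, F z n i = Λ n * tableQ α (v z n) i + Λ n * tableB α (v z (n + 1)) (v z n) i
      + (if n = 0 then 0 else Λ (n - 1) * tableA α (v z (n - 1)) i) := by
    intro z n i
    simp only [hF, PiLp.add_apply, PiLp.smul_apply, smul_eq_mul]
    split_ifs <;> simp
  set G : (Fin (K + 1) × Fin m → ℝ) → (Fin (K + 1) × Fin m → ℝ) :=
    fun z p => if p.2 ∈ D p.1 then F z p.1 p.2 else 0 with hG
  -- the dark modes and the frozen shells feel no field
  have F_dark : ∀ z n i, i ∉ D n → F z n i = 0 := by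
    intro z n i hi
    rw [F_apply, tableQ_apply_eq_zero_of_supported (hA n) (v_supp z n) hi,
      tableB_apply_eq_zero_of_chain (hB n) (v_supp z (n + 1)) (v_supp z n) hi]
    simp only [mul_zero, zero_add]
    split_ifs with hn
    · rfl
    · have hn1 : n - 1 + 1 = n := by omega
      rw [tableA_apply_eq_zero_of_chain (D' := D (n - 1 + 1)) (hO (n - 1)) (v_supp z (n - 1))
        (by rw [hn1]; exact hi), mul_zero]
  have F_high : ∀ z n i, K + 1 ≤ n → F z n i = 0 := by
    intro z n i hn
    by_cases hi : i ∈ D n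
    · -- `D n` is not assumed empty above `K+1`, but the shell vectors vanish there
      rw [F_apply, v_high z n hn, v_high z (n + 1) (by omega), (table_maps_zero α 0 0).2.1,
        (table_maps_zero α 0 0).2.2.1, PiLp.zero_apply, mul_zero, zero_add, zero_add, if_neg (by omega)]
      rcases Nat.lt_or_ge (K + 1) n with h | h
      · rw [v_high z (n - 1) (by omega), (table_maps_zero α 0 0).1, PiLp.zero_apply, mul_zero]
      · have hK : n - 1 = K := by omega
        rw [hK, tableA_apply_eq_zero_of_chain (D' := D (K + 1)) (hO K) (v_supp z K)
          (by rw [hDK]; exact Finset.notMem_empty i), mul_zero]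
    · exact F_dark z n i hi
  -- energy neutrality and smoothness of `G`
  have hGc : ∀ z, ∑ p, G z p * z p = 0 := by
    intro z
    have h1 : ∑ p, G z p * z p = ∑ s : Fin (K + 1), ⟪v z s, F z s⟫ := by
      rw [Fintype.sum_prod_type]
      refine Finset.sum_congr rfl fun s _ => ?_
      rw [inner_eq_sum_mul]
      refine Finset.sum_congr rfl fun i _ => ?_
      by_cases hi : i ∈ D s
      · simp only [hG, hi, if_true, v_mem z s i hi]; ring
      · simp only [hG, hi, if_false, v_supp z s i hi, zero_mul]
    rw [h1]
    exact sum_inner_truncatedField_eq_zero hc K Λ (v z) (v_high z (K + 1) le_rfl)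
  have hvc : ∀ n j, ContDiff ℝ 1 (fun z : Fin (K + 1) × Fin m → ℝ => v z n j) := by
    intro n j
    by_cases h : n < K + 1
    · by_cases hj : j ∈ D n
      · simp only [v_apply, h, dif_pos, hj, if_true]
        exact contDiff_apply ℝ ℝ ((⟨n, h⟩ : Fin (K + 1)), j)
      · simp only [v_apply, h, dif_pos, hj, if_false]
        exact contDiff_const
    · simp only [v_apply, h, dif_neg, not_false_eq_true]
      exact contDiff_const
  have hQc : ∀ n i, ContDiff ℝ 1 (fun z : Fin (K + 1) × Fin m → ℝ => tableQ α (v z n) i) := by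
    intro n i
    simp only [tableQ_apply, qform]
    exact ContDiff.sum fun j _ => ContDiff.sum fun k _ => contDiff_const.mul ((hvc n j).mul (hvc n k))
  have hAc : ∀ n i, ContDiff ℝ 1 (fun z : Fin (K + 1) × Fin m → ℝ => tableA α (v z n) i) := by
    intro n i
    simp only [tableA_apply, qform]
    exact ContDiff.sum fun j _ => ContDiff.sum fun k _ => contDiff_const.mul ((hvc n j).mul (hvc n k))
  have hBc : ∀ n n' i, ContDiff ℝ 1 (fun z : Fin (K + 1) × Fin m → ℝ => tableB α (v z n') (v z n) i) := by
    intro n n' i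
    simp only [tableB_apply, qform]
    exact (ContDiff.sum fun j _ => ContDiff.sum fun k _ => contDiff_const.mul ((hvc n' j).mul (hvc n k))).add
      (ContDiff.sum fun j _ => ContDiff.sum fun k _ => contDiff_const.mul ((hvc n j).mul (hvc n' k)))
  have hFc : ∀ n i, ContDiff ℝ 1 (fun z : Fin (K + 1) × Fin m → ℝ => F z n i) := by
    intro n i
    simp only [F_apply]
    by_cases hn : n = 0
    · simp only [hn, if_true, add_zero]
      exact (contDiff_const.mul (hQc 0 i)).add (contDiff_const.mul (hBc 0 (0 + 1) i))
    · simp only [hn, if_false]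
      exact ((contDiff_const.mul (hQc n i)).add (contDiff_const.mul (hBc n (n + 1) i))).add
        (contDiff_const.mul (hAc (n - 1) i))
  have hG' : ContDiff ℝ 1 G := by
    refine contDiff_pi.2 fun p => ?_
    by_cases hp : p.2 ∈ D p.1
    · simp only [hG, hp, if_true]; exact hFc p.1 p.2
    · simp only [hG, hp, if_false]; exact contDiff_const
  -- the global trajectory from the datum
  set z₀ : Fin (K + 1) × Fin m → ℝ := fun p => if (p.1 : ℕ) = 0 then X₀ p.2 else 0 with hz₀
  obtain ⟨Z, hZ0, hZ, hZb⟩ := exists_solution_of_sum_mul_eq_zero G hGc hG' z₀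
  have hZd : ∀ t (s : Fin (K + 1)) i, HasDerivAt (fun t => Z t (s, i)) (G (Z t) (s, i)) t :=
    fun t s i => (hasDerivAt_pi.1 (hZ t)) (s, i)
  -- the lattice family: shell `n ≥ 0` carries `v (Z t) n`, shells `n < 0` nothing
  set X : Fin m → ℤ → ℝ → ℝ := fun i n t => if 0 ≤ n then v (Z t) n.toNat i else 0 with hX
  have hXsv : ∀ n t, shellVec X n t = if 0 ≤ n then v (Z t) n.toNat else 0 := by
    intro n t; ext i; simp only [shellVec_apply, hX]; split_ifs <;> rfl
  -- the nonlinearity on the family, shell by shell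
  have hA0 : tableA α (0 : Em m) = 0 := (table_maps_zero α 0 0).1
  have hQ0 : tableQ α (0 : Em m) = 0 := (table_maps_zero α 0 0).2.1
  have hBv0 : ∀ w : Em m, tableB α w 0 = 0 := fun w => (table_maps_zero α w w).2.2.1
  have hq_neg : ∀ i (n : ℤ) t, n < 0 → quadTerm ε₀ α X i n t = 0 := by
    intro i n t hn
    rw [quadTerm_eq_tables, hXsv, hXsv, hXsv, if_neg (show ¬ (0 : ℤ) ≤ n by omega),
      if_neg (show ¬ (0 : ℤ) ≤ n - 1 by omega), hQ0, hBv0, hA0]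
    simp
  have hq_nat : ∀ i (s : ℕ) t, quadTerm ε₀ α X i (s : ℤ) t = F (Z t) s i := by
    intro i s t
    rw [quadTerm_eq_tables, hXsv, hXsv, hXsv, if_pos (by omega), if_pos (by omega), Int.toNat_natCast,
      show ((s : ℤ) + 1).toNat = s + 1 by omega, F_apply]
    have hcast : ((s : ℤ) : ℝ) = (s : ℝ) := by simp
    rw [hcast]
    by_cases hs : s = 0
    · subst hs
      simp [hΛ, hA0]
    · rw [if_pos (by omega), show ((s : ℤ) - 1).toNat = s - 1 by omega, if_neg hs]
      have hcast' : ((s : ℝ) - 1) = ((s - 1 : ℕ) : ℝ) := by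
        rw [Nat.cast_sub (by omega)]; simp
      rw [hcast', hΛ]
  refine ⟨X, fun i k => ?_, fun i k t _ => ?_,
    ⟨(∑ s : Fin (K + 1), |1 + (1 + ε₀) ^ ((10 : ℝ) * ((s : ℕ) : ℝ))|) * Real.sqrt (∑ r, z₀ r ^ 2),
      fun t _ i k => ?_⟩⟩
  · -- datum
    simp only [hX, hZ0]
    by_cases hk : k = 0
    · subst hk
      rw [if_pos le_rfl, if_pos rfl, Int.toNat_zero, v_apply, dif_pos (by omega)]
      by_cases hi : i ∈ D 0
      · rw [if_pos hi, hz₀]; simp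
      · rw [if_neg hi, hX₀ i hi]
    · rw [if_neg hk]
      split_ifs with hk0
      · rw [v_apply]
        split_ifs with h1 h2
        · rw [hz₀]; simp only; rw [if_neg (by omega)]
        · rfl
        · rfl
      · rfl
  · -- exact motion
    rcases lt_or_ge k 0 with hk | hk
    · rw [hq_neg i k t hk]
      have : X i k = fun _ => 0 := by funext t'; simp [hX, not_le.2 hk]
      rw [this]; exact hasDerivWithinAt_const _ _ _
    · obtain ⟨s, rfl⟩ := Int.eq_ofNat_of_zero_le hk
      rw [hq_nat i s t]
      have hXs : X i (s : ℤ) = fun t' => v (Z t') s i := by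
        funext t'; simp [hX]
      rw [hXs]
      by_cases hs : s < K + 1
      · by_cases hi : i ∈ D s
        · have hfun : (fun t' => v (Z t') s i) = fun t' => Z t' (⟨s, hs⟩, i) := by
            funext t'; exact v_mem (Z t') ⟨s, hs⟩ i hi
          rw [hfun]
          have h := hZd t ⟨s, hs⟩ i
          simp only [hG, hi, if_true] at h
          exact h.hasDerivWithinAt
        · have hfun : (fun t' => v (Z t') s i) = fun _ => 0 := by funext t'; exact v_supp (Z t') s i hi
          rw [hfun, F_dark (Z t) s i hi]
          exact hasDerivWithinAt_const _ _ _
      · have hfun : (fun t' => v (Z t') s i) = fun _ => 0 := by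
          funext t'; rw [v_high (Z t') s (by omega)]; rfl
        rw [hfun, F_high (Z t) s i (by omega)]
        exact hasDerivWithinAt_const _ _ _
  · -- a priori weight (4.5)
    have hS : 0 ≤ Real.sqrt (∑ r, z₀ r ^ 2) := Real.sqrt_nonneg _
    have hW : 0 ≤ ∑ s : Fin (K + 1), |1 + (1 + ε₀) ^ ((10 : ℝ) * ((s : ℕ) : ℝ))| :=
      Finset.sum_nonneg fun s _ => abs_nonneg _
    rcases lt_or_ge k 0 with hk | hk
    · have : X i k t = 0 := by simp [hX, not_le.2 hk]
      rw [this, abs_zero, mul_zero]; positivity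
    · obtain ⟨s, rfl⟩ := Int.eq_ofNat_of_zero_le hk
      have hXs : X i (s : ℤ) t = v (Z t) s i := by simp [hX]
      rw [hXs]
      by_cases hs : s < K + 1
      · have hb : |v (Z t) s i| ≤ Real.sqrt (∑ r, z₀ r ^ 2) := by
          by_cases hi : i ∈ D s
          · rw [v_mem (Z t) ⟨s, hs⟩ i hi]; exact hZb t (⟨s, hs⟩, i)
          · rw [v_supp (Z t) s i hi, abs_zero]; exact hS
        have hw : 1 + (1 + ε₀) ^ ((10 : ℝ) * ((s : ℤ) : ℝ)) ≤
            ∑ s : Fin (K + 1), |1 + (1 + ε₀) ^ ((10 : ℝ) * ((s : ℕ) : ℝ))| := by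
          have hcast : ((s : ℤ) : ℝ) = (((⟨s, hs⟩ : Fin (K + 1)) : ℕ) : ℝ) := by simp
          rw [hcast]
          exact (le_abs_self _).trans (Finset.single_le_sum
            (f := fun s : Fin (K + 1) => |1 + (1 + ε₀) ^ ((10 : ℝ) * ((s : ℕ) : ℝ))|)
            (fun s _ => abs_nonneg _) (Finset.mem_univ (⟨s, hs⟩ : Fin (K + 1))))
        by_cases hpos : 0 ≤ 1 + (1 + ε₀) ^ ((10 : ℝ) * ((s : ℤ) : ℝ))
        · exact mul_le_mul hw hb (abs_nonneg _) hW
        · push Not at hpos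
          exact le_trans (mul_nonpos_of_nonpos_of_nonneg hpos.le (abs_nonneg _)) (by positivity)
      · rw [v_high (Z t) s (by omega), PiLp.zero_apply, abs_zero, mul_zero]; positivity

/-- **NO ROBUST BLOW-UP FROM DATA SUPPORTED IN A FINITE-DEPTH CHAIN.**  If `α ∈ E₂(R)` has a support chain `D` of depth
`K`, then `NoGlobalCascade ε₀ α X₀` FAILS for every `ε₀ > 0` and every one-shell datum supported in `D 0`
(`noRegularExactFlow_of_noGlobalCascade` against the global exact flow above).
[cite: Tao2016AveragedNS, §4 Thm. 4.2 (statement shape), Lemma 4.1 (4.5)–(4.8), §5 p. 25; cell vocabulary (`NoGlobalCascade`)] -/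
theorem not_noGlobalCascade_of_supportChain (hε : 0 < ε₀) (hα : InTableClass R α) {K : ℕ}
    {D : ℕ → Finset (Fin m)} (hDK : D (K + 1) = ∅)
    (hO : ∀ n j k i, j ∈ D n → k ∈ D n → i ∉ D (n + 1) → α j k i ((0 : ℤ), (0 : ℤ), (1 : ℤ)) = 0)
    (hA : ∀ n j k i, j ∈ D n → k ∈ D n → i ∉ D n → α j k i ((0 : ℤ), (0 : ℤ), (0 : ℤ)) = 0)
    (hB : ∀ n j k i, j ∈ D (n + 1) → k ∈ D n → i ∉ D n →
      α j k i ((1 : ℤ), (0 : ℤ), (0 : ℤ)) = 0 ∧ α k j i ((0 : ℤ), (1 : ℤ), (0 : ℤ)) = 0)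
    {X₀ : Fin m → ℝ} (hX₀ : ∀ i, i ∉ D 0 → X₀ i = 0) : ¬ NoGlobalCascade ε₀ α X₀ := by
  intro hNG
  obtain ⟨T, _, hno⟩ := noRegularExactFlow_of_noGlobalCascade hε hα hNG
  exact hno (exists_regularExactFlow_of_supportChain hα.2.1 hDK hO hA hB ε₀ hX₀ T)

/-- **FINITE-DEPTH TABLES NEVER BLOW UP ROBUSTLY**: with `D 0 = univ` (every one-shell datum allowed), a table of
`E₂(R)` with a support chain of depth `K` has `¬ NoGlobalCascade ε₀ α X₀` for EVERY `ε₀ > 0` and EVERY `X₀` — so K2(1)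
and the rung leaf `Target` hold on it with no threshold (vacuously).  One-hop tables are depth `1`.
[cite: Tao2016AveragedNS, §4 Thm. 4.2 (statement shape); cell vocabulary (`NoGlobalCascade`, K2(1), `Target`)] -/
theorem not_noGlobalCascade_of_supportChain_univ (hε : 0 < ε₀) (hα : InTableClass R α) {K : ℕ}
    {D : ℕ → Finset (Fin m)} (hD0 : D 0 = Finset.univ) (hDK : D (K + 1) = ∅)
    (hO : ∀ n j k i, j ∈ D n → k ∈ D n → i ∉ D (n + 1) → α j k i ((0 : ℤ), (0 : ℤ), (1 : ℤ)) = 0)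
    (hA : ∀ n j k i, j ∈ D n → k ∈ D n → i ∉ D n → α j k i ((0 : ℤ), (0 : ℤ), (0 : ℤ)) = 0)
    (hB : ∀ n j k i, j ∈ D (n + 1) → k ∈ D n → i ∉ D n →
      α j k i ((1 : ℤ), (0 : ℤ), (0 : ℤ)) = 0 ∧ α k j i ((0 : ℤ), (1 : ℤ), (0 : ℤ)) = 0)
    (X₀ : Fin m → ℝ) : ¬ NoGlobalCascade ε₀ α X₀ :=
  not_noGlobalCascade_of_supportChain hε hα hDK hO hA hB fun i hi => absurd (hD0 ▸ Finset.mem_univ i) hi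

end BlowupRigidityOne

end Summit.NavierStokesRegularity.NavierStokesRegularity.Theorems

end
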